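import Summits.MatrixMultiplication.OmegaCensus.SmallFormats.MatMul22nLoadedPlaneStructure
import HarnessLib

/-!
# ω-census family (a): rank-one SHAPES forced by a non-degenerate cheap pairing, and the double-cell recombination (any field)

Cell `pub-omega` (unit `pub-omega-tensor`, gen 40), topic `Summits/MatrixMultiplication/OmegaCensus` (sub-folder
`SmallFormats`). Framing (verbatim): lottery ticket; floor = certified bounds/negative ranges. HONEST FRAMING: §7(b) of tensor g40's memo
DEFLATION-g40 as abstract linear algebra over any field, stated for a pair of rows `rows : Fin 2 → kⁿ` (the two rows of a Y-form
coefficient matrix `G_t`, or of an output `W_t`) lying in a cheap 2-plane `span(c 0, c 1)`: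
* `RankOneShapes.combo_eq_zero_of_nondeg` — if the `ν`-combination of the rows pairs to zero with test vectors `d 0, d 1` and the pairing
  `span(c) × span(d)` is non-degenerate on the `c` side, the `ν`-combination of the rows is ZERO;
* `RankOneShapes.exists_rankOne_of_combo_eq_zero` — `ν ≠ 0` and `∑ ν_κ rows κ = 0` ⇒ the rows are multiples `η κ • g` of ONE vector `g`
  (a row), i.e. the matrix is rank-one on the line `g`, and `g ∈ span(c)`;
* `RankOneShapes.prop_of_perp₂` — in `k²`, two vectors orthogonal to the same non-zero vector are proportional;
* `RankOneShapes.exists_recombination_on_line` — the DOUBLE-CELL step: two row-pairs `ra, rb` in `span(c)` whose `ν`-combinations pair to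
  zero with `d`, a vector `g ∈ span(c)`, `g ≠ 0`, `g ⊥ d`, and some `g' ∈ span(c)` with `g' · d m₀ ≠ 0`: some non-trivial combination
  `x ra + y rb` has BOTH rows on the line `g`.
Nothing here is a bound on `ω`; the M2 glue (memo §7(c)) consumes these.
-/

namespace Summit.MatrixMultiplication.OmegaCensus.SmallFormats

open Finset Module Matrix

namespace RankOneShapes

variable {k : Type*} [Field k] {n : ℕ}

/-- **Non-degenerate pairing kills the cheap combination.** -/
theorem combo_eq_zero_of_nondeg (c d : Fin 2 → (Fin n → k)) (rows : Fin 2 → (Fin n → k)) (ν : Fin 2 → k)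
    (hrows : ∀ κ, ∃ a : Fin 2 → k, rows κ = ∑ m, a m • c m)
    (hcheap : ∀ m, (∑ κ, ν κ • rows κ) ⬝ᵥ d m = 0)
    (hnondeg : ∀ a : Fin 2 → k, (∀ m, (∑ l, a l • c l) ⬝ᵥ d m = 0) → ∑ l, a l • c l = 0) :
    ∑ κ, ν κ • rows κ = 0 := by
  choose a ha using hrows
  have hx : ∑ κ, ν κ • rows κ = ∑ l, (∑ κ, ν κ * a κ l) • c l := by
    simp_rw [ha, Finset.smul_sum, smul_smul, Finset.sum_smul]
    rw [Finset.sum_comm]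
  rw [hx] at hcheap ⊢
  exact hnondeg _ hcheap

/-- **`ν ≠ 0` and `∑ ν_κ rows κ = 0` ⇒ rank one on a row.** There are `η : Fin 2 → k` and `g` — one of the two rows — with
`rows κ = η κ • g` for both `κ`; moreover `g ∈ span(c)` if the rows are, and `g ≠ 0` unless both rows vanish. -/
theorem exists_rankOne_of_combo_eq_zero (rows : Fin 2 → (Fin n → k)) (ν : Fin 2 → k) (hν : ν ≠ 0)
    (h0 : ∑ κ, ν κ • rows κ = 0) :
    ∃ (η : Fin 2 → k) (κ₀ : Fin 2), ∀ κ, rows κ = η κ • rows κ₀ := by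
  rw [Fin.sum_univ_two] at h0
  by_cases h1 : ν 1 = 0
  · have h0' : ν 0 ≠ 0 := by
      intro h; apply hν; funext i; fin_cases i <;> simp [h, h1]
    rw [h1, zero_smul, add_zero] at h0
    have hr0 : rows 0 = 0 := by
      have := congrArg (fun v => (ν 0)⁻¹ • v) h0
      simpa [smul_smul, inv_mul_cancel₀ h0'] using this
    refine ⟨![0, 1], 1, fun κ => ?_⟩
    fin_cases κ
    · simp [hr0]
    · simp
  · refine ⟨![1, -(ν 0) / ν 1], 0, fun κ => ?_⟩
    fin_cases κ
    · simp
    · have : rows 1 = (-(ν 0) / ν 1) • rows 0 := by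
        have h := congrArg (fun v => (ν 1)⁻¹ • v) h0
        simp only [smul_add, smul_smul, inv_mul_cancel₀ h1, one_smul, smul_zero] at h
        have e : -(ν 0) / ν 1 = -((ν 1)⁻¹ * ν 0) := by rw [div_eq_mul_inv]; ring
        rw [e, neg_smul]
        exact eq_neg_of_add_eq_zero_right h
      simpa using this

/-- In `k²`: if `(α, β) ≠ 0`, `p α + q β = 0`, `p₀ α + q₀ β = 0` and `(p₀, q₀) ≠ 0`, then `(p, q) = η (p₀, q₀)` for some `η`. -/
theorem prop_of_perp₂ (α β p q p₀ q₀ : k) (hαβ : α ≠ 0 ∨ β ≠ 0) (h : p * α + q * β = 0) (h₀ : p₀ * α + q₀ * β = 0)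
    (hpq₀ : p₀ ≠ 0 ∨ q₀ ≠ 0) : ∃ η : k, p = η * p₀ ∧ q = η * q₀ := by
  rcases hαβ with hα | hβ
  · -- p = -q β/α, p₀ = -q₀ β/α ; q₀ ≠ 0
    have hq₀ : q₀ ≠ 0 := by
      rcases hpq₀ with hp₀ | hq₀
      · intro hq; apply hp₀
        have : p₀ * α = 0 := by rw [hq, zero_mul, add_zero] at h₀; exact h₀
        exact (mul_eq_zero.mp this).resolve_right hα
      · exact hq₀
    refine ⟨q / q₀, ?_, by field_simp⟩
    have e1 : p = -(q * β) / α := by field_simp; linear_combination h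
    have e2 : p₀ = -(q₀ * β) / α := by field_simp; linear_combination h₀
    rw [e1, e2]; field_simp
  · have hp₀ : p₀ ≠ 0 := by
      rcases hpq₀ with hp₀ | hq₀'
      · exact hp₀
      · intro hp; apply hq₀'
        have : q₀ * β = 0 := by rw [hp, zero_mul, zero_add] at h₀; exact h₀
        exact (mul_eq_zero.mp this).resolve_right hβ
    refine ⟨p / p₀, by field_simp, ?_⟩
    have e1 : q = -(p * α) / β := by field_simp; linear_combination h
    have e2 : q₀ = -(p₀ * α) / β := by field_simp; linear_combination h₀
    rw [e1, e2]; field_simp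

/-- **The double-cell recombination.** Two row-pairs `ra, rb` in the 2-plane `span(c)` whose `ν`-combinations pair to zero with the test
vectors `d m` (`ν ≠ 0`); a vector `g = ∑ p₀ • c` on which `d` vanishes, with `(p₀) ≠ 0`; and SOME element of `span(c)` pairing
non-trivially with some `d m₀`. Then a non-trivial combination `x • ra + y • rb` has both rows on the line `g`. -/
theorem exists_recombination_on_line (c d : Fin 2 → (Fin n → k)) (ν : Fin 2 → k) (hν : ν ≠ 0)
    (ra rb : Fin 2 → (Fin n → k)) (hra : ∀ κ, ∃ a : Fin 2 → k, ra κ = ∑ m, a m • c m)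
    (hrb : ∀ κ, ∃ a : Fin 2 → k, rb κ = ∑ m, a m • c m)
    (hca : ∀ m, (∑ κ, ν κ • ra κ) ⬝ᵥ d m = 0) (hcb : ∀ m, (∑ κ, ν κ • rb κ) ⬝ᵥ d m = 0)
    (p₀ : Fin 2 → k) (hp₀ : p₀ ≠ 0) (hg : ∀ m, (∑ l, p₀ l • c l) ⬝ᵥ d m = 0)
    (m₀ : Fin 2) (hm₀ : (c 0 ⬝ᵥ d m₀) ≠ 0 ∨ (c 1 ⬝ᵥ d m₀) ≠ 0) :
    ∃ x y : k, (x ≠ 0 ∨ y ≠ 0) ∧ ∃ η : Fin 2 → k, ∀ κ, x • ra κ + y • rb κ = η κ • ∑ l, p₀ l • c l := by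
  classical
  -- ψ(r) := r ⬝ᵥ d m₀ on span(c); coordinates of each row
  choose aa haa using hra
  choose ab hab using hrb
  set α := c 0 ⬝ᵥ d m₀ with hα
  set β := c 1 ⬝ᵥ d m₀ with hβ
  have hψ : ∀ (a : Fin 2 → k), (∑ l, a l • c l) ⬝ᵥ d m₀ = a 0 * α + a 1 * β := by
    intro a
    rw [Fin.sum_univ_two, add_dotProduct, smul_dotProduct, smul_dotProduct, smul_eq_mul, smul_eq_mul]
  -- ψ-values of the rows: ψa κ := ψ(ra κ)
  let ψa : Fin 2 → k := fun κ => aa κ 0 * α + aa κ 1 * β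
  let ψb : Fin 2 → k := fun κ => ab κ 0 * α + ab κ 1 * β
  have hψa : ∀ κ, ra κ ⬝ᵥ d m₀ = ψa κ := fun κ => by rw [haa κ, hψ]
  have hψb : ∀ κ, rb κ ⬝ᵥ d m₀ = ψb κ := fun κ => by rw [hab κ, hψ]
  -- cheapness at m₀: ν ⬝ ψa = 0, ν ⬝ ψb = 0
  have hνa : ν 0 * ψa 0 + ν 1 * ψa 1 = 0 := by
    have h := hca m₀
    rw [Fin.sum_univ_two, add_dotProduct, smul_dotProduct, smul_dotProduct, hψa, hψa, smul_eq_mul, smul_eq_mul] at h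
    exact h
  have hνb : ν 0 * ψb 0 + ν 1 * ψb 1 = 0 := by
    have h := hcb m₀
    rw [Fin.sum_univ_two, add_dotProduct, smul_dotProduct, smul_dotProduct, hψb, hψb, smul_eq_mul, smul_eq_mul] at h
    exact h
  have hν' : ν 0 ≠ 0 ∨ ν 1 ≠ 0 := by
    by_contra h; push Not at h; apply hν; funext i; fin_cases i <;> simp [h.1, h.2]
  -- choose (x, y) ≠ 0 with x ψa + y ψb = 0 (both ψa, ψb lie on the line ν^⊥)
  obtain ⟨x, y, hxy, hrel⟩ : ∃ x y : k, (x ≠ 0 ∨ y ≠ 0) ∧ ∀ κ, x * ψa κ + y * ψb κ = 0 := by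
    by_cases hb0 : ψb = 0
    · refine ⟨0, 1, Or.inr one_ne_zero, fun κ => ?_⟩
      simp [hb0]
    · -- ψb ≠ 0: ψa = η ψb by prop_of_perp₂ (both ⊥ ν)
      have hb' : ψb 0 ≠ 0 ∨ ψb 1 ≠ 0 := by
        by_contra h; push Not at h; apply hb0; funext i; fin_cases i <;> simp [h.1, h.2]
      obtain ⟨η, h1, h2⟩ := prop_of_perp₂ (ν 0) (ν 1) (ψa 0) (ψa 1) (ψb 0) (ψb 1) hν'
        (by linear_combination hνa) (by linear_combination hνb) hb'
      refine ⟨1, -η, Or.inl one_ne_zero, fun κ => ?_⟩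
      fin_cases κ
      · simp [h1]
      · simp [h2]
  refine ⟨x, y, hxy, ?_⟩
  -- each row r := x ra κ + y rb κ lies in span(c) with ψ(r) = 0, hence on the line g (prop_of_perp₂ with (α, β) ≠ 0)
  have hg0 : p₀ 0 * α + p₀ 1 * β = 0 := by rw [← hψ]; exact hg m₀
  have hp₀' : p₀ 0 ≠ 0 ∨ p₀ 1 ≠ 0 := by
    by_contra h; push Not at h; apply hp₀; funext i; fin_cases i <;> simp [h.1, h.2]
  have key : ∀ κ, ∃ ηκ : k, x • ra κ + y • rb κ = ηκ • ∑ l, p₀ l • c l := by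
    intro κ
    -- coordinates of the row
    let pr : k := x * aa κ 0 + y * ab κ 0
    let qr : k := x * aa κ 1 + y * ab κ 1
    have hr : x • ra κ + y • rb κ = ∑ l, (![pr, qr] : Fin 2 → k) l • c l := by
      rw [haa κ, hab κ, Fin.sum_univ_two, Fin.sum_univ_two, Fin.sum_univ_two]
      simp only [smul_add, smul_smul, Matrix.cons_val_zero, Matrix.cons_val_one]
      simp only [pr, qr, add_smul]
      abel
    have hperp : pr * α + qr * β = 0 := by
      have h := hrel κ
      simp only [ψa, ψb] at h
      simp only [pr, qr]
      linear_combination h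
    obtain ⟨ηκ, e1, e2⟩ := prop_of_perp₂ α β pr qr (p₀ 0) (p₀ 1) hm₀ hperp hg0 hp₀'
    refine ⟨ηκ, ?_⟩
    rw [hr, Fin.sum_univ_two, Fin.sum_univ_two]
    simp only [Matrix.cons_val_zero, Matrix.cons_val_one, e1, e2, smul_add, smul_smul]
  choose ηf hηf using key
  exact ⟨ηf, hηf⟩

end RankOneShapes

end Summit.MatrixMultiplication.OmegaCensus.SmallFormats
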